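import Summits.ValiantsHypothesis.ValiantsHypothesis.Theorems.LacunarySymmetroidMatrixDescartesNsdPivotLoneParallelRows
import Summits.ValiantsHypothesis.ValiantsHypothesis.Theorems.LacunarySymmetroidMatrixDescartesCensusDoorA34InteriorUnfolding

/-!
# `MatrixDescartes` (stmt-ValiantsHypothesis-18050) — THE TILTED CLUSTER: designed `(1 | K−1)` NSD pencils with `2K − 1` positive
# roots (rank-one lone letter) and `2K` positive roots (full-rank lone letter) FOR EVERY `K ≥ 3` — both tree ceilings attained

HONEST FRAMING.  Cell `pub-symmetroid`, seat `val-sym-mdr-p2` (gen 29); helper file `--supports` the crux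
`Theses.LacunarySymmetroid.MatrixDescartes` (OPEN), NO closure claim.  Third file of the seat's design series
(`…NsdPivotLoneParallelDesign`: the oblique parallel cluster, `2K − 2` / `2K − 1` roots by a persistence + domination induction;
`…NsdPivotLoneParallelRows`: its rows and the full-rank signed certificate).

THE TILT.  In the parallel design every upper letter is `A_k t^{D_k} e₂e₂ᵀ`; its Descartes pattern stops at `2K − 2` (rank-one lone)
because the top of the determinant is `−A_top t^{D_top + 1} < 0` and no positive term lies above it.  Tilt the TOP letter off `e₂`:
`a tⁿ (ε, 1)(ε, 1)ᵀ` (still rank one).  Then (`eval_det_tilted`, lone letter `!![1,1;1,c]`, tail cluster `q = ∑ At_k t^{Dt_k}`)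
    `det = (1 − t)(a tⁿ + q) − t(2 − t) + (c − 1)(1 − t) + a tⁿ (−2ε + ε² (c − t + q))`:
the parallel determinant plus a TILT TERM whose `ε² a tⁿ q` part is the CROSS TERM of the two non-parallel directions — positive, of
degree `n + Dt₀ ≥ n + 2`, above everything else (`≤ n + 1`).  So for every fixed `ε > 0` the determinant is eventually POSITIVE
(`tilt_pos_at_large`: an explicit `T ≥ 2` with every lower term bounded by `(∑ At + 4a + (c − 1)) T^{n + Dt₀ − 1}`), while for
`ε → 0⁺` the tilt term is uniformly small at the finitely many certificate points of the parallel design in `(0, 1]`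
(`tilt_certificate`: `Filter.eventually_all`, then domination at `T`): ONE MORE SIGN CHANGE beyond `t = 1`.  With the signed
certificates of the companions this gives, for every `G` (`K = G + 3` letters: lone, tilted top, `G + 1` parallel):
* `exists_tilted_rankOne_design (G)`: a GENUINE rank-one-lone `(1 | K−1)` NSD pencil with `Z₊ ≥ 2G + 5 = 2K − 1` — the END-LAW
  ceiling of gen 27 (`NsdLoneRankOne.pivotPosRoots_succ_le_of_lone_below`) is ATTAINED for every `K ≥ 3`;
* `exists_tilted_fullRank_design (G)`: lone letter `!![1,1;1,1+δ]` of full rank, `Z₊ ≥ 2G + 6 = 2K` — the NSD `2K` law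
  (`DefinitePivot.pivotPosRoots_le_two_mul_of_det_nonneg`) is ATTAINED on `(1 | K−1)` for every `K ≥ 3`.
The exact rows (iff-with-budget, `= 2K − 1` / `= 2K`, `K = 5`: `9` / `10`) are filed in the companion `…NsdPivotLoneTiltedRows`.  Anatomy of
the `2K − 1`: one root near `0` only in the full-rank case (`δ`), `2(K − 2)` roots in `(0, 1)` from the parallel cascade (each new
letter lives closer to `1`, exponents growing geometrically), and ONE root beyond `t = 1` from the tilt (located numerically at
`t ≈ 60–250` for `ε = 10⁻²`): the razor-thin `10⁻⁴`-windows of the hunted sevens (gen 28) are not needed.  Nothing here bears on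
`MatrixDescartes` in its window, on `DoorA26` / `DoorA34`, on the cell's registers beyond the `(1 | K−1)` NSD sub-rows, or on `VP ≠ VNP`.

[folklore] Elementary real analysis (intermediate value theorem via `Pivot.le_pivotPosRoots_of_certificate`, continuity in `ε`,
explicit polynomial domination); the design is this seat's (gen 29).
-/

set_option linter.dupNamespace false

namespace Summit.ValiantsHypothesis.ValiantsHypothesis.Theorems.LacunarySymmetroidMatrixDescartes.Pivot.NsdLoneTiltedDesign

open Polynomial Matrix Finset Filter Topology NsdLoneParallelDesign NsdLoneParallelRows
open scoped BigOperators

/-! ## 1. The tilted design and its determinant -/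

/-- **The determinant of the tilted design.**  Pivot `−1` at exponent `1`; lone letter `!![1, 1; 1, c]` at exponent `0`; the TOP
upper letter `a·(ε, 1)(ε, 1)ᵀ` at exponent `n` (tilted by `ε` off `e₂`); the other upper letters `!![0, 0; 0, At k]` at exponents
`Dt k`:  `det = (1 − t)(tⁿ a + q) − t(2 − t) + (c − 1)(1 − t) + a tⁿ (−2ε + ε² (c − t + q))`, `q = ∑ₖ t^{Dt k} At k` — the
parallel determinant plus the TILT TERM, whose `ε² a tⁿ q` part is the top cross term. [folklore] -/
theorem eval_det_tilted {G : ℕ} (n : ℕ) (Dt : Fin G → ℕ) (a : ℝ) (At : Fin G → ℝ) (ε c t : ℝ) :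
    (t ^ 1 • (!![(-1 : ℝ), 0; 0, -1] : Matrix (Fin 2) (Fin 2) ℝ)
      + ∑ k, t ^ (Fin.cons 0 (Fin.cons n Dt) : Fin (G + 1 + 1) → ℕ) k •
        (Fin.cons (!![(1 : ℝ), 1; 1, c]) (Fin.cons (!![a * ε ^ 2, a * ε; a * ε, a]) (fun k => !![(0 : ℝ), 0; 0, At k]))
          : Fin (G + 1 + 1) → Matrix (Fin 2) (Fin 2) ℝ) k).det
      = (1 - t) * (t ^ n * a + ∑ k, t ^ Dt k * At k) - t * (2 - t) + (c - 1) * (1 - t)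
        + a * t ^ n * (-2 * ε + ε ^ 2 * (c - t + ∑ k, t ^ Dt k * At k)) := by
  rw [Matrix.det_fin_two]
  simp [Matrix.add_apply, Matrix.sum_apply, Fin.sum_univ_succ]
  ring

/-! ## 2. Elementary lemmas -/

/-- Appending a larger value to a strictly increasing tuple keeps it strictly increasing. [folklore] -/
theorem strictMono_snoc {N : ℕ} {f : Fin N → ℝ} (hf : StrictMono f) {b : ℝ} (hb : ∀ j, f j < b) :
    StrictMono (Fin.snoc f b : Fin (N + 1) → ℝ) := by
  intro i j hij
  cases j using Fin.lastCases with
  | last =>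
    cases i using Fin.lastCases with
    | last => exact absurd hij (lt_irrefl _)
    | cast i' => simpa using hb i'
  | cast j' =>
    cases i using Fin.lastCases with
    | last => exact absurd ((Fin.castSucc_lt_last j').trans hij) (lt_irrefl _)
    | cast i' => simpa using hf (Fin.castSucc_lt_castSucc_iff.mp hij)

-- `Census.mul_add_pos_of_abs_lt` (tree, `…CensusDoorA34InteriorUnfolding`): `|y| < |x| → 0 < x * (x + y)` is reused below.

/-- A strict sign alternation survives perturbations smaller than the values. [folklore] -/
theorem alternation_persists_of_abs_lt {x y u v : ℝ} (hxu : x * u < 0) (hy : |y| < |x|) (hv : |v| < |u|) :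
    (x + y) * (u + v) < 0 := by
  have h1 := Census.mul_add_pos_of_abs_lt hy
  have h2 := Census.mul_add_pos_of_abs_lt hv
  have h : 0 < (x * u) * ((x + y) * (u + v)) := by nlinarith [mul_pos h1 h2]
  by_contra hcon
  have : (x * u) * ((x + y) * (u + v)) ≤ 0 := mul_nonpos_of_nonpos_of_nonneg hxu.le (not_lt.mp hcon)
  linarith

/-- The tail cluster is bounded by its top exponent: `q(t) ≤ t^{Dt 0} ∑ At` for `t ≥ 1`. [folklore] -/
theorem tail_sum_le {G : ℕ} (Dt : Fin (G + 1) → ℕ) (At : Fin (G + 1) → ℝ) (hDt : ∀ k, Dt k ≤ Dt 0)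
    (hAt : ∀ k, 0 < At k) {t : ℝ} (ht : 1 ≤ t) : ∑ k, t ^ Dt k * At k ≤ t ^ Dt 0 * ∑ k, At k := by
  rw [Finset.mul_sum]
  exact Finset.sum_le_sum fun k _ => mul_le_mul_of_nonneg_right (pow_le_pow_right₀ ht (hDt k)) (hAt k).le

/-- The tail cluster dominates its top letter: `t^{Dt 0} At 0 ≤ q(t)` for `t ≥ 0`. [folklore] -/
theorem le_tail_sum {G : ℕ} (Dt : Fin (G + 1) → ℕ) (At : Fin (G + 1) → ℝ) (hAt : ∀ k, 0 < At k) {t : ℝ} (ht : 0 ≤ t) :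
    t ^ Dt 0 * At 0 ≤ ∑ k, t ^ Dt k * At k :=
  Finset.single_le_sum (f := fun k => t ^ Dt k * At k) (fun k _ => mul_nonneg (pow_nonneg ht _) (hAt k).le)
    (Finset.mem_univ 0)

/-! ## 3. The tilt term wins at large `t`: one more (certified) positive value beyond `t = 2` -/

/-- **Domination at large `t`.**  For `0 < ε ≤ 1`, `c ≥ 1`, a top exponent `n > Dt 0 ≥ Dt k`, `Dt 0 ≥ 2`, the tilted determinant is
POSITIVE at some `T ≥ 2`: its top cross term `ε² a At₀ t^{n + Dt 0}` beats every other term (all of degree `≤ n + 1 ≤ n + Dt 0 − 1`)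
once `t > (∑ At + 4a + (c − 1)) / (ε² a At₀)`. [folklore] -/
theorem tilt_pos_at_large {G : ℕ} (n : ℕ) (Dt : Fin (G + 1) → ℕ) (a : ℝ) (At : Fin (G + 1) → ℝ) (ε c : ℝ)
    (hn : Dt 0 < n) (hDt : ∀ k, Dt k ≤ Dt 0) (hDt2 : 2 ≤ Dt 0) (ha : 0 < a) (hAt : ∀ k, 0 < At k)
    (hε0 : 0 < ε) (hε1 : ε ≤ 1) (hc : 1 ≤ c) :
    ∃ T : ℝ, 2 ≤ T ∧ 0 < (1 - T) * (T ^ n * a + ∑ k, T ^ Dt k * At k) - T * (2 - T) + (c - 1) * (1 - T)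
        + a * T ^ n * (-2 * ε + ε ^ 2 * (c - T + ∑ k, T ^ Dt k * At k)) := by
  set S : ℝ := ∑ k, At k with hS
  have hS0 : 0 ≤ S := Finset.sum_nonneg fun k _ => (hAt k).le
  set Ctot : ℝ := S + 4 * a + (c - 1) with hCtot
  have hκ : 0 < ε ^ 2 * a * At 0 := by have := hAt 0; positivity
  set T : ℝ := max 2 (Ctot / (ε ^ 2 * a * At 0) + 1) with hT
  have hT2 : 2 ≤ T := le_max_left _ _
  have hT1 : 1 ≤ T := by linarith
  have hT0 : 0 ≤ T := by linarith
  have hkey : Ctot < ε ^ 2 * a * At 0 * T := by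
    have h1 : Ctot / (ε ^ 2 * a * At 0) < T := lt_of_lt_of_le (by linarith) (le_max_right _ _)
    rwa [div_lt_iff₀ hκ, mul_comm] at h1
  refine ⟨T, hT2, ?_⟩
  -- exponent bookkeeping: `n + Dt 0 = m + 1`, `Dt 0 + 1 ≤ m`, `n + 1 ≤ m`
  obtain ⟨m, hm⟩ : ∃ m, n + Dt 0 = m + 1 := ⟨n + Dt 0 - 1, by omega⟩
  have hm1 : Dt 0 + 1 ≤ m := by omega
  have hm2 : n + 1 ≤ m := by omega
  set q : ℝ := ∑ k, T ^ Dt k * At k with hq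
  have hq0 : 0 ≤ q := Finset.sum_nonneg fun k _ => mul_nonneg (pow_nonneg hT0 _) (hAt k).le
  have hqle : q ≤ T ^ Dt 0 * S := tail_sum_le Dt At hDt hAt hT1
  have hqge : T ^ (Dt 0) * At 0 ≤ q := le_tail_sum Dt At hAt hT0
  -- powers of `T`
  have hPn : 0 ≤ T ^ n := pow_nonneg hT0 _
  have hPd : 0 ≤ T ^ Dt 0 := pow_nonneg hT0 _
  have hPm : 0 < T ^ m := pow_pos (by linarith) _
  have hp1 : T ^ (Dt 0 + 1) ≤ T ^ m := pow_le_pow_right₀ hT1 hm1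
  have hp2 : T ^ (n + 1) ≤ T ^ m := pow_le_pow_right₀ hT1 hm2
  have hp3 : T ≤ T ^ (n + 1) := by
    have := pow_le_pow_right₀ hT1 (show 1 ≤ n + 1 by omega); rwa [pow_one] at this
  have hp4 : T ^ n ≤ T ^ (n + 1) := pow_le_pow_right₀ hT1 (Nat.le_succ n)
  have hPd1 : T ^ (Dt 0 + 1) = T ^ Dt 0 * T := pow_succ _ _
  have hPn1 : T ^ (n + 1) = T ^ n * T := pow_succ _ _
  have hPm1 : T ^ (m + 1) = T ^ m * T := pow_succ _ _
  have hPnd : T ^ n * T ^ Dt 0 = T ^ (m + 1) := by rw [← pow_add, hm]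
  -- the expansion
  have hE : (1 - T) * (T ^ n * a + q) - T * (2 - T) + (c - 1) * (1 - T)
        + a * T ^ n * (-2 * ε + ε ^ 2 * (c - T + q))
      = (1 - T) * q + (a * T ^ n - a * T ^ (n + 1)) + T * (T - 2) + (c - 1) * (1 - T) - 2 * (ε * a * T ^ n)
        + (ε ^ 2 * a * c * T ^ n - ε ^ 2 * a * T ^ (n + 1)) + ε ^ 2 * a * (T ^ n * q) := by ring
  rw [hE]
  -- the seven bounds
  have hb1 : -(S * T ^ (Dt 0 + 1)) ≤ (1 - T) * q := by
    have h1 : T * q ≤ T * (T ^ Dt 0 * S) := mul_le_mul_of_nonneg_left hqle hT0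
    have h2 : T * (T ^ Dt 0 * S) = S * T ^ (Dt 0 + 1) := by rw [pow_succ]; ring
    have h3 : (1 - T) * q = q - T * q := by ring
    rw [h3]; linarith
  have hb2 : 0 ≤ a * T ^ n := mul_nonneg ha.le hPn
  have hb3 : 0 ≤ T * (T - 2) := mul_nonneg hT0 (by linarith)
  have hc1 : 0 ≤ c - 1 := by linarith
  have hb4 : -((c - 1) * T ^ (n + 1)) ≤ (c - 1) * (1 - T) := by
    have h1 : (c - 1) * T ≤ (c - 1) * T ^ (n + 1) := mul_le_mul_of_nonneg_left hp3 hc1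
    have h2 : (c - 1) * (1 - T) = (c - 1) - (c - 1) * T := by ring
    rw [h2]; linarith
  have hb5 : ε * a * T ^ n ≤ a * T ^ (n + 1) := by
    have h1 : ε * (a * T ^ n) ≤ 1 * (a * T ^ n) := mul_le_mul_of_nonneg_right hε1 hb2
    have h2 : a * T ^ n ≤ a * T ^ (n + 1) := mul_le_mul_of_nonneg_left hp4 ha.le
    have h3 : ε * a * T ^ n = ε * (a * T ^ n) := by ring
    rw [h3]; linarith
  have hb6a : 0 ≤ ε ^ 2 * a * c * T ^ n :=
    mul_nonneg (mul_nonneg (mul_nonneg (sq_nonneg ε) ha.le) (by linarith)) hPn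
  have hb6b : ε ^ 2 * a * T ^ (n + 1) ≤ a * T ^ (n + 1) := by
    have hε2 : ε ^ 2 ≤ 1 := pow_le_one₀ hε0.le hε1
    have h0 : 0 ≤ a * T ^ (n + 1) := mul_nonneg ha.le (pow_nonneg hT0 _)
    have h1 : ε ^ 2 * (a * T ^ (n + 1)) ≤ 1 * (a * T ^ (n + 1)) := mul_le_mul_of_nonneg_right hε2 h0
    have h2 : ε ^ 2 * a * T ^ (n + 1) = ε ^ 2 * (a * T ^ (n + 1)) := by ring
    rw [h2]; linarith
  have hb7 : ε ^ 2 * a * At 0 * T ^ (m + 1) ≤ ε ^ 2 * a * (T ^ n * q) := by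
    have h0 : 0 ≤ ε ^ 2 * a := mul_nonneg (sq_nonneg ε) ha.le
    have h1 : T ^ n * (T ^ Dt 0 * At 0) ≤ T ^ n * q := mul_le_mul_of_nonneg_left hqge hPn
    have h2 : ε ^ 2 * a * (T ^ n * (T ^ Dt 0 * At 0)) ≤ ε ^ 2 * a * (T ^ n * q) := mul_le_mul_of_nonneg_left h1 h0
    have h3 : ε ^ 2 * a * (T ^ n * (T ^ Dt 0 * At 0)) = ε ^ 2 * a * At 0 * T ^ (m + 1) := by
      rw [← hPnd]; ring
    rw [h3] at h2; exact h2
  -- combine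
  have hq1 : S * T ^ (Dt 0 + 1) ≤ S * T ^ m := mul_le_mul_of_nonneg_left hp1 hS0
  have hq2 : a * T ^ (n + 1) ≤ a * T ^ m := mul_le_mul_of_nonneg_left hp2 ha.le
  have hq3 : (c - 1) * T ^ (n + 1) ≤ (c - 1) * T ^ m := mul_le_mul_of_nonneg_left hp2 hc1
  have hfin : Ctot * T ^ m < ε ^ 2 * a * At 0 * T ^ (m + 1) := by
    rw [hPm1, show ε ^ 2 * a * At 0 * (T ^ m * T) = (ε ^ 2 * a * At 0 * T) * T ^ m by ring]
    exact mul_lt_mul_of_pos_right hkey hPm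
  have hCt : Ctot * T ^ m = S * T ^ m + 4 * (a * T ^ m) + (c - 1) * T ^ m := by rw [hCtot]; ring
  linarith

/-! ## 4. Tilting a certified parallel design: every old sign persists for small `ε`, and one more sign change appears beyond `t = 1` -/

/-- **The tilt extension of a certificate.**  Let `g₀` be the determinant of a parallel design with lone letter `!![1,1;1,c]`, top
letter `a tⁿ e₂e₂ᵀ` and tail cluster `(Dt, At)`, certified to alternate strictly along `0 < τ 0 < ⋯ < τ N ≤ 1` with
`g₀ (τ N) < 0`.  Then for some `0 < ε ≤ 1` and `T ≥ 2` the TILTED determinant `g₀ + a tⁿ(−2ε + ε²(c − t + q))` alternates strictly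
along the `N + 2` points `τ 0, …, τ N, T` (persistence at the old points as `ε → 0⁺`; domination at `T`, §3). [folklore] -/
theorem tilt_certificate {N G : ℕ} (n : ℕ) (Dt : Fin (G + 1) → ℕ) (a : ℝ) (At : Fin (G + 1) → ℝ) (c : ℝ)
    (hn : Dt 0 < n) (hDt : ∀ k, Dt k ≤ Dt 0) (hDt2 : 2 ≤ Dt 0) (ha : 0 < a) (hAt : ∀ k, 0 < At k) (hc : 1 ≤ c)
    (g₀ : ℝ → ℝ) (hg₀ : ∀ t, g₀ t = (1 - t) * (t ^ n * a + ∑ k, t ^ Dt k * At k) - t * (2 - t) + (c - 1) * (1 - t))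
    (τ : Fin (N + 1) → ℝ) (hτ : StrictMono τ) (hτ0 : ∀ i, 0 < τ i) (hτ1 : ∀ i, τ i ≤ 1)
    (halt : ∀ j : Fin N, g₀ (τ j.castSucc) * g₀ (τ j.succ) < 0) (hlast : g₀ (τ (Fin.last N)) < 0) :
    ∃ (ε T : ℝ), 0 < ε ∧ ε ≤ 1 ∧ 2 ≤ T ∧ StrictMono (Fin.snoc τ T : Fin (N + 1 + 1) → ℝ) ∧
      (∀ i, 0 < (Fin.snoc τ T : Fin (N + 1 + 1) → ℝ) i) ∧
      ∀ j : Fin (N + 1),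
        (g₀ ((Fin.snoc τ T : Fin (N + 1 + 1) → ℝ) j.castSucc) + a * (Fin.snoc τ T : Fin (N + 1 + 1) → ℝ) j.castSucc ^ n *
            (-2 * ε + ε ^ 2 * (c - (Fin.snoc τ T : Fin (N + 1 + 1) → ℝ) j.castSucc
              + ∑ k, (Fin.snoc τ T : Fin (N + 1 + 1) → ℝ) j.castSucc ^ Dt k * At k))) *
        (g₀ ((Fin.snoc τ T : Fin (N + 1 + 1) → ℝ) j.succ) + a * (Fin.snoc τ T : Fin (N + 1 + 1) → ℝ) j.succ ^ n *
            (-2 * ε + ε ^ 2 * (c - (Fin.snoc τ T : Fin (N + 1 + 1) → ℝ) j.succ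
              + ∑ k, (Fin.snoc τ T : Fin (N + 1 + 1) → ℝ) j.succ ^ Dt k * At k))) < 0 := by
  -- the old values do not vanish
  have hne : ∀ i : Fin (N + 1), g₀ (τ i) ≠ 0 := by
    intro i
    cases i using Fin.lastCases with
    | last => exact hlast.ne
    | cast i' => exact fun h => by have := halt i'; rw [h, zero_mul] at this; exact lt_irrefl _ this
  -- the tilt term as a function of `ε` at a fixed point
  set p : ℝ → ℝ → ℝ := fun t ε => a * t ^ n * (-2 * ε + ε ^ 2 * (c - t + ∑ k, t ^ Dt k * At k)) with hp
  have hpc : ∀ t, Tendsto (fun ε => |p t ε|) (𝓝 0) (𝓝 0) := fun t => by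
    have h : Continuous fun ε : ℝ => |p t ε| := by rw [hp]; fun_prop
    exact h.tendsto' 0 0 (by simp [hp])
  -- a small positive `ε ≤ 1` below every margin
  obtain ⟨ε, hε0, hε1, hεm⟩ : ∃ ε : ℝ, 0 < ε ∧ ε ≤ 1 ∧ ∀ i, |p (τ i) ε| < |g₀ (τ i)| := by
    have h1 : ∀ᶠ ε in 𝓝[>] (0 : ℝ), ∀ i, |p (τ i) ε| < |g₀ (τ i)| :=
      nhdsWithin_le_nhds (eventually_all.2 fun i => (hpc (τ i)).eventually_lt_const (abs_pos.mpr (hne i)))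
    have h2 : ∀ᶠ ε in 𝓝[>] (0 : ℝ), ε ∈ Set.Ioo (0 : ℝ) 1 := Ioo_mem_nhdsGT zero_lt_one
    obtain ⟨ε, h, hI⟩ := (h1.and h2).exists
    exact ⟨ε, hI.1, hI.2.le, h⟩
  -- domination beyond `t = 2`
  obtain ⟨T, hT2, hTpos⟩ := tilt_pos_at_large n Dt a At ε c hn hDt hDt2 ha hAt hε0 hε1 hc
  have hτT : ∀ j, τ j < T := fun j => by linarith [hτ1 j]
  refine ⟨ε, T, hε0, hε1, hT2, strictMono_snoc hτ hτT, fun i => ?_, fun j => ?_⟩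
  · cases i using Fin.lastCases with
    | last => simp; linarith
    | cast i' => simpa using hτ0 i'
  · cases j using Fin.lastCases with
    | last =>
      -- the last pair: `τ N` (old value negative, perturbation small) against `T` (positive)
      rw [Fin.succ_last, Fin.snoc_last, Fin.snoc_castSucc]
      have h1 : g₀ (τ (Fin.last N)) + p (τ (Fin.last N)) ε < 0 := by
        have := Census.mul_add_pos_of_abs_lt (hεm (Fin.last N))
        nlinarith
      have h2 : 0 < g₀ T + p T ε := by rw [hg₀, hp]; exact hTpos
      simp only [hp] at h1 h2
      exact mul_neg_of_neg_of_pos h1 h2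
    | cast j' =>
      rw [Fin.snoc_castSucc, Fin.succ_castSucc, Fin.snoc_castSucc]
      have h := alternation_persists_of_abs_lt (halt j') (hεm j'.castSucc) (hεm j'.succ)
      simpa only [hp] using h

/-! ## 5. The designs: `2K − 1` rank-one-lone roots and `2K` free-lone roots, for every `K ≥ 3` -/

/-- **THE TILTED CLUSTER, rank-one lone letter: `2G + 5 = 2K − 1` positive roots at `K = G + 3`, every `G`.**  Pivot `−1` at exponent
`1`, rank-one lone letter `(1,1)(1,1)ᵀ` at `0`, top letter `a·(ε,1)(ε,1)ᵀ` at `n`, `G + 1` parallel rank-one letters `diag(0, At k)` at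
`Dt k < n` (all exponents pairwise distinct, all letters rank one and non-zero). [folklore] -/
theorem exists_tilted_rankOne_design (G : ℕ) :
    ∃ (n : ℕ) (Dt : Fin (G + 1) → ℕ) (a : ℝ) (At : Fin (G + 1) → ℝ) (ε : ℝ),
      (∀ k, Dt k < n) ∧ StrictAnti Dt ∧ (∀ k, 2 ≤ Dt k) ∧ 0 < a ∧ (∀ k, 0 < At k) ∧ 0 < ε ∧
      2 * G + 5 ≤ pivotPosRoots 1 (Fin.cons 0 (Fin.cons n Dt) : Fin (G + 1 + 1 + 1) → ℕ)
        (!![(-1 : ℝ), 0; 0, -1] : Matrix (Fin 2) (Fin 2) ℝ)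
        (Fin.cons (!![(1 : ℝ), 1; 1, 1]) (Fin.cons (!![a * ε ^ 2, a * ε; a * ε, a]) (fun k => !![(0 : ℝ), 0; 0, At k]))
          : Fin (G + 1 + 1 + 1) → Matrix (Fin 2) (Fin 2) ℝ) := by
  obtain ⟨D, A, τ, hD, hD2, hA, hτ, hτ0, hτ1, hsign⟩ := exists_signed_certificate (G + 2)
  -- split off the top letter: `n = D 0`, `a = A 0`, tail `Fin.tail D`, `Fin.tail A`
  have hsum : ∀ t : ℝ, ∑ k, t ^ D k * A k = t ^ D 0 * A 0 + ∑ k : Fin (G + 1), t ^ D k.succ * A k.succ :=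
    fun t => Fin.sum_univ_succ _
  have hg₀ : ∀ t, (fun t : ℝ => (1 - t) * (∑ k, t ^ D k * A k) - t * (2 - t)) t
      = (1 - t) * (t ^ D 0 * A 0 + ∑ k : Fin (G + 1), t ^ (Fin.tail D) k * (Fin.tail A) k) - t * (2 - t)
        + (1 - 1) * (1 - t) := fun t => by
    simp only [hsum, Fin.tail]; ring
  have halt : ∀ j : Fin (2 * (G + 2)), (fun t : ℝ => (1 - t) * (∑ k, t ^ D k * A k) - t * (2 - t)) (τ j.castSucc)
      * (fun t : ℝ => (1 - t) * (∑ k, t ^ D k * A k) - t * (2 - t)) (τ j.succ) < 0 :=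
    alternate_of_signed (τ := τ) (g := fun t : ℝ => (1 - t) * (∑ k, t ^ D k * A k) - t * (2 - t)) hsign
  have hlast : (fun t : ℝ => (1 - t) * (∑ k, t ^ D k * A k) - t * (2 - t)) (τ (Fin.last _)) < 0 := by
    have h := hsign (Fin.last _)
    rw [Fin.val_last, Even.neg_one_pow ⟨G + 2, by ring⟩, one_mul] at h
    exact h
  obtain ⟨ε, T, hε0, hε1, _, hmono, hpos, halt'⟩ := tilt_certificate (N := 2 * (G + 2)) (D 0) (Fin.tail D) (A 0)
    (Fin.tail A) 1 (hD (Fin.succ_pos 0)) (fun k => hD.antitone (Fin.succ_le_succ_iff.mpr (Fin.zero_le k))) (hD2 _) (hA 0)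
    (fun k => hA _) le_rfl _ hg₀ τ hτ hτ0 hτ1 halt hlast
  refine ⟨D 0, Fin.tail D, A 0, Fin.tail A, ε, fun k => hD (Fin.succ_pos k), fun i j h => hD (Fin.succ_lt_succ_iff.mpr h),
    fun k => hD2 _, hA 0, fun k => hA _, hε0, ?_⟩
  have h : 2 * (G + 2) + 1 ≤ pivotPosRoots 1 (Fin.cons 0 (Fin.cons (D 0) (Fin.tail D)) : Fin (G + 1 + 1 + 1) → ℕ)
      (!![(-1 : ℝ), 0; 0, -1] : Matrix (Fin 2) (Fin 2) ℝ)
      (Fin.cons (!![(1 : ℝ), 1; 1, 1]) (Fin.cons (!![A 0 * ε ^ 2, A 0 * ε; A 0 * ε, A 0])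
        (fun k => !![(0 : ℝ), 0; 0, Fin.tail A k])) : Fin (G + 1 + 1 + 1) → Matrix (Fin 2) (Fin 2) ℝ) :=
    le_pivotPosRoots_of_certificate (N := 2 * (G + 2) + 1)
      (f := fun t => (fun t : ℝ => (1 - t) * (∑ k, t ^ D k * A k) - t * (2 - t)) t
        + A 0 * t ^ D 0 * (-2 * ε + ε ^ 2 * (1 - t + ∑ k, t ^ (Fin.tail D) k * (Fin.tail A) k)))
      (fun t => by rw [eval_det_tilted, hg₀]) (Fin.snoc τ T) hmono hpos halt'
  omega

/-- **THE TILTED CLUSTER, full-rank lone letter: `2G + 6 = 2K` positive roots at `K = G + 3`, every `G`** (lone letter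
`!![1, 1; 1, 1 + δ]`, the rest as in `exists_tilted_rankOne_design`). [folklore] -/
theorem exists_tilted_fullRank_design (G : ℕ) :
    ∃ (n : ℕ) (Dt : Fin (G + 1) → ℕ) (a : ℝ) (At : Fin (G + 1) → ℝ) (ε δ : ℝ),
      (∀ k, Dt k < n) ∧ StrictAnti Dt ∧ (∀ k, 2 ≤ Dt k) ∧ 0 < a ∧ (∀ k, 0 < At k) ∧ 0 < ε ∧ 0 < δ ∧
      2 * G + 6 ≤ pivotPosRoots 1 (Fin.cons 0 (Fin.cons n Dt) : Fin (G + 1 + 1 + 1) → ℕ)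
        (!![(-1 : ℝ), 0; 0, -1] : Matrix (Fin 2) (Fin 2) ℝ)
        (Fin.cons (!![(1 : ℝ), 1; 1, 1 + δ]) (Fin.cons (!![a * ε ^ 2, a * ε; a * ε, a]) (fun k => !![(0 : ℝ), 0; 0, At k]))
          : Fin (G + 1 + 1 + 1) → Matrix (Fin 2) (Fin 2) ℝ) := by
  obtain ⟨D, A, δ, τ, hD, hD2, hA, hδ0, hτ, hτ0, hτ1, hsign⟩ := exists_signed_certificate_fullRank (G + 2)
  have hsum : ∀ t : ℝ, ∑ k, t ^ D k * A k = t ^ D 0 * A 0 + ∑ k : Fin (G + 1), t ^ D k.succ * A k.succ :=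
    fun t => Fin.sum_univ_succ _
  have hg₀ : ∀ t, (fun t : ℝ => (1 - t) * (∑ k, t ^ D k * A k) - t * (2 - t) + δ * (1 - t)) t
      = (1 - t) * (t ^ D 0 * A 0 + ∑ k : Fin (G + 1), t ^ (Fin.tail D) k * (Fin.tail A) k) - t * (2 - t)
        + (1 + δ - 1) * (1 - t) := fun t => by
    simp only [hsum, Fin.tail]; ring
  have halt : ∀ j : Fin (2 * (G + 2) + 1),
      (fun t : ℝ => (1 - t) * (∑ k, t ^ D k * A k) - t * (2 - t) + δ * (1 - t)) (τ j.castSucc)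
      * (fun t : ℝ => (1 - t) * (∑ k, t ^ D k * A k) - t * (2 - t) + δ * (1 - t)) (τ j.succ) < 0 := fun j => by
    have h := alternate_of_signed (τ := τ)
      (g := fun t => -((1 - t) * (∑ k, t ^ D k * A k) - t * (2 - t) + δ * (1 - t))) (fun i => by
        have := hsign i; linarith) j
    rwa [neg_mul_neg] at h
  have hlast : (fun t : ℝ => (1 - t) * (∑ k, t ^ D k * A k) - t * (2 - t) + δ * (1 - t)) (τ (Fin.last _)) < 0 := by
    have h := hsign (Fin.last _)
    rw [Fin.val_last, Odd.neg_one_pow ⟨G + 2, by ring⟩] at h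
    simp only
    linarith
  obtain ⟨ε, T, hε0, hε1, _, hmono, hpos, halt'⟩ := tilt_certificate (N := 2 * (G + 2) + 1) (D 0) (Fin.tail D) (A 0)
    (Fin.tail A) (1 + δ) (hD (Fin.succ_pos 0)) (fun k => hD.antitone (Fin.succ_le_succ_iff.mpr (Fin.zero_le k))) (hD2 _)
    (hA 0) (fun k => hA _) (by linarith) _ hg₀ τ hτ hτ0 hτ1 halt hlast
  refine ⟨D 0, Fin.tail D, A 0, Fin.tail A, ε, δ, fun k => hD (Fin.succ_pos k), fun i j h => hD (Fin.succ_lt_succ_iff.mpr h),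
    fun k => hD2 _, hA 0, fun k => hA _, hε0, hδ0, ?_⟩
  have h : 2 * (G + 2) + 1 + 1 ≤ pivotPosRoots 1 (Fin.cons 0 (Fin.cons (D 0) (Fin.tail D)) : Fin (G + 1 + 1 + 1) → ℕ)
      (!![(-1 : ℝ), 0; 0, -1] : Matrix (Fin 2) (Fin 2) ℝ)
      (Fin.cons (!![(1 : ℝ), 1; 1, 1 + δ]) (Fin.cons (!![A 0 * ε ^ 2, A 0 * ε; A 0 * ε, A 0])
        (fun k => !![(0 : ℝ), 0; 0, Fin.tail A k])) : Fin (G + 1 + 1 + 1) → Matrix (Fin 2) (Fin 2) ℝ) :=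
    le_pivotPosRoots_of_certificate (N := 2 * (G + 2) + 1 + 1)
      (f := fun t => (fun t : ℝ => (1 - t) * (∑ k, t ^ D k * A k) - t * (2 - t) + δ * (1 - t)) t
        + A 0 * t ^ D 0 * (-2 * ε + ε ^ 2 * (1 + δ - t + ∑ k, t ^ (Fin.tail D) k * (Fin.tail A) k)))
      (fun t => by rw [eval_det_tilted, hg₀]) (Fin.snoc τ T) hmono hpos halt'
  omega

end Summit.ValiantsHypothesis.ValiantsHypothesis.Theorems.LacunarySymmetroidMatrixDescartes.Pivot.NsdLoneTiltedDesign
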